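import Literature.Analysis.PDE.WeakHarnackCubeCondition
import Literature.MeasureTheory.Covering.KrylovSafonovDistribution
import HarnessLib

/-!
# The weak Harnack inequality, normalized (Gilbarg–Trudinger Thm 9.22 on the unit ball)

Assembly of the Krylov–Safonov argument on the unit ball `B₁` of `EuclideanSpace ℝ ι`
(`n = |ι| ≥ 1`): for `u ≥ 0` of class `C²` near `B̄₁`, measurable, with `a^{ij}D_{ij}u ≤ f`,
`|f| ≤ N`, `N > 0`, symmetric `λ ≤ a ≤ Λ`, and parameters `0 < α` with `3α√n < 1`, `β = m+2` with
`nΛ ≤ 2(β-1)λα²`: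

`∫_{B_α(0)} (u + N)^p ≤ C (u(x) + N)^p` for every `x ∈ B_α(0)` (`setLIntegral_rpow_le_normalized`),

with `p = κ/2` and explicit `C`, `κ` depending only on `n, λ, Λ, m, α` — GT's (9.61) (average and
infimum over the same small ball; see the module docstring of `WeakHarnackCubeCondition` for the
normalization). The chain is `cubeCondition_negLog` (9.57) ⇒ `Dyadic.sub_le_of_cube_condition`
(Lemma 9.23, (9.59)) ⇒ `Dyadic.lintegral_rpow_exp_neg_le` ((9.60)–(9.61)) ⇒ change of variables
along the chart.

## References

* D. Gilbarg, N. S. Trudinger, *Elliptic Partial Differential Equations of Second Order* (2001),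
  Theorem 9.22 and its proof, (9.57)–(9.61). [GilbargTrudinger2001]
-/

noncomputable section

open Set InnerProductSpace Matrix Filter Metric MeasureTheory WithLp
open scoped Topology ENNReal RealInnerProductSpace

namespace Literature.Analysis.PDE.KrylovSafonov

open Literature.Analysis.PDE.ABP Literature.MeasureTheory.Covering.Dyadic

variable {ι : Type*} [Fintype ι] [DecidableEq ι]

omit [DecidableEq ι] [Fintype ι] in
/-- `C₁ > 0`. [folklore] -/
theorem supBound_pos {n : ℕ} (hn : n ≠ 0) {lam Λ : ℝ} (hlam : 0 < lam) (hΛ : 0 ≤ Λ) (m : ℕ) :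
    0 < supBound n lam Λ m := by
  unfold supBound coreK₁
  have hn' : (0 : ℝ) < n := by exact_mod_cast Nat.pos_of_ne_zero hn
  apply Real.rpow_pos_of_pos
  positivity

/-- The `δ` of Lemma 9.23 for our data: `δ = 1 - θ ∈ [1/2, 1)`. [cite: GilbargTrudinger2001, (9.58)] -/
def deltaWH (ι : Type*) [Fintype ι] (lam Λ : ℝ) (m : ℕ) (α : ℝ) : ℝ := 1 - thetaCube ι lam Λ m α

/-- The `C` of Lemma 9.23 for our data: `C = C₁/(1 - 9α²n)^{m+2}`. [cite: GilbargTrudinger2001, (9.57)] -/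
def growthC (n : ℕ) (lam Λ : ℝ) (m : ℕ) (α : ℝ) : ℝ :=
  supBound n lam Λ m / (1 - (3 * α * Real.sqrt n) ^ 2) ^ (m + 2)

/-- **The exponent** `p = κ/2`, `κ = log(1/δ)/C`. [cite: GilbargTrudinger2001, proof of Thm 9.22
("say p = κ/2")] -/
def expWH (ι : Type*) [Fintype ι] (lam Λ : ℝ) (m : ℕ) (α : ℝ) : ℝ :=
  kappa (deltaWH ι lam Λ m α) (growthC (Fintype.card ι) lam Λ m α) / 2

/-- **The constant** `(2α)ⁿ (1 + 1/δ)` hmm precisely `(2α)ⁿ (1 + p/(δ(κ - p)))` with `p = κ/2`.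
[cite: GilbargTrudinger2001, (9.61)] -/
def constWH (ι : Type*) [Fintype ι] (lam Λ : ℝ) (m : ℕ) (α : ℝ) : ℝ :=
  (2 * α) ^ Fintype.card ι * (1 + (deltaWH ι lam Λ m α)⁻¹)

/-- **GT Theorem 9.22, normalized (small-ball form on the unit ball).** Under the hypotheses of
`cubeCondition_negLog`, for every `x ∈ B_α(0)`:
`∫_{B_α(0)} (u + N)^p ≤ C · (u(x) + N)^p` with `p = expWH`, `C = constWH`.
[cite: GilbargTrudinger2001, Theorem 9.22 (proof, (9.61))] -/
theorem setLIntegral_rpow_le_normalized [Nonempty ι] {U : Set (EuclideanSpace ℝ ι)} (hU : IsOpen U)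
    (hBU : closedBall (0 : EuclideanSpace ℝ ι) 1 ⊆ U) {u f : EuclideanSpace ℝ ι → ℝ} {N : ℝ}
    (hu : ContDiffOn ℝ 2 u U) (hu0 : ∀ y ∈ closedBall (0 : EuclideanSpace ℝ ι) 1, 0 ≤ u y)
    (hmeas : Measurable u) (hN : 0 < N) (hf : ∀ y ∈ ball (0 : EuclideanSpace ℝ ι) 1, |f y| ≤ N)
    {a : EuclideanSpace ℝ ι → Matrix ι ι ℝ} (ha : ∀ y ∈ ball (0 : EuclideanSpace ℝ ι) 1, (a y).IsSymm)
    {lam Λ : ℝ} (hlam0 : 0 < lam) (hΛ0 : 0 ≤ Λ)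
    (hlam : ∀ y ∈ ball (0 : EuclideanSpace ℝ ι) 1, ∀ ξ : ι → ℝ, lam * (ξ ⬝ᵥ ξ) ≤ ξ ⬝ᵥ (a y *ᵥ ξ))
    (hΛ : ∀ y ∈ ball (0 : EuclideanSpace ℝ ι) 1, ∀ ξ : ι → ℝ, ξ ⬝ᵥ (a y *ᵥ ξ) ≤ Λ * (ξ ⬝ᵥ ξ))
    (hsuper : ∀ y ∈ ball (0 : EuclideanSpace ℝ ι) 1,
      pair (a y) (hessianMatrix u (EuclideanSpace.basisFun ι ℝ) y) ≤ f y)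
    {m : ℕ} {α : ℝ} (hα0 : 0 < α) (hρ1 : 3 * α * Real.sqrt (Fintype.card ι) < 1)
    (hβl : Fintype.card ι * Λ ≤ 2 * (((m + 2 : ℕ) : ℝ) - 1) * lam * α ^ 2)
    {x : EuclideanSpace ℝ ι} (hx : x ∈ ball (0 : EuclideanSpace ℝ ι) α) :
    ∫⁻ y in ball (0 : EuclideanSpace ℝ ι) α, ENNReal.ofReal ((u y + N) ^ expWH ι lam Λ m α) ≤
      ENNReal.ofReal (constWH ι lam Λ m α * (u x + N) ^ expWH ι lam Λ m α) := by
  set n := Fintype.card ι with hn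
  have hn0 : n ≠ 0 := Fintype.card_ne_zero
  set δ := deltaWH ι lam Λ m α with hδ
  set C := growthC n lam Λ m α with hC
  set κ := kappa δ C with hκ
  set p := expWH ι lam Λ m α with hp
  set w' : (ι → ℝ) → ℝ := fun t ↦ -Real.log (u (chart α t) + N) with hw'
  have hn1 : (1 : ℝ) ≤ n := by exact_mod_cast Fintype.card_pos
  have hsqn : 1 ≤ Real.sqrt n := by rw [← Real.sqrt_one]; exact Real.sqrt_le_sqrt hn1
  have hα1 : α ^ 2 < 1 := by nlinarith
  obtain ⟨hθ0, hθhalf⟩ := thetaCube_pos (ι := ι) hlam0 hΛ0 m hα0 hα1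
  have hδ0 : 0 < δ := by rw [hδ, deltaWH]; linarith
  have hδ1 : δ < 1 := by rw [hδ, deltaWH]; linarith
  have hρsq : (3 * α * Real.sqrt n) ^ 2 < 1 := by
    have : 0 ≤ 3 * α * Real.sqrt n := by positivity
    nlinarith
  have hC0 : 0 < C := by
    rw [hC, growthC]
    exact div_pos (supBound_pos hn0 hlam0 hΛ0 m) (pow_pos (by linarith) _)
  have hκ0 : 0 < κ := kappa_pos hδ0 hδ1 hC0
  have hp0 : 0 < p := by rw [hp, expWH]; exact half_pos hκ0
  have hpκ : p < κ := by rw [hp, expWH]; exact half_lt_self hκ0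
  -- (9.57): the cube condition
  have hcc : CubeCondition w' δ C := by
    rw [hδ, deltaWH, hC, growthC]
    exact cubeCondition_negLog hU hBU hu hu0 hmeas hN hf ha hlam0 hΛ0 hlam hΛ hsuper hα0 hρ1 hβl
  -- (9.59)
  have hw'm : Measurable w' :=
    (Real.measurable_log.comp ((hmeas.comp (continuous_chart α).measurable).add_const N)).neg
  have H59 : ∀ k : ℝ, 0 < volume (subLevel w' k) → ∀ t ∈ dyadicCube (ι := ι) 0 0,
      w' t - k ≤ C * (1 + Real.log (volume (subLevel w' k)).toReal / Real.log δ) :=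
    fun k hk t ht ↦ sub_le_of_cube_condition hw'm hδ0 hδ1 hC0.le hcc hk ht
  -- the point `x` in the chart
  set t₀ : ι → ℝ := fun i ↦ (x.ofLp i + α) / (2 * α) with ht₀
  have hxt₀ : chart α t₀ = x := by
    unfold chart
    have : (fun i ↦ 2 * α * t₀ i - α) = x.ofLp := by
      funext i; rw [ht₀]; field_simp; ring
    rw [this]
  have hcoordx : ∀ i, |x.ofLp i| < α := fun i ↦
    lt_of_le_of_lt (abs_ofLp_le_norm x i) (mem_ball_zero_iff.1 hx)
  have hunit : ∀ t : ι → ℝ, t ∈ dyadicCube (ι := ι) 0 0 ↔ ∀ i, 0 ≤ t i ∧ t i < 1 := fun t ↦ by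
    rw [unitCube_eq, Set.mem_univ_pi]; simp only [mem_Ico]
  have ht₀cube : t₀ ∈ dyadicCube (ι := ι) 0 0 := by
    rw [hunit]; intro i
    have h := hcoordx i; rw [abs_lt] at h
    have e : t₀ i = (x.ofLp i + α) / (2 * α) := rfl
    rw [e]
    constructor
    · exact div_nonneg (by linarith) (by positivity)
    · rw [div_lt_one (by positivity)]; linarith
  -- (9.61) on the unit cube
  have h61 := lintegral_rpow_exp_neg_le hw'm hδ0 hδ1 hC0 H59 ht₀cube hp0 hpκ
  -- identify `e^{-w'} = (u ∘ chart) + N` on the cube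
  have hpos_cube : ∀ t ∈ dyadicCube (ι := ι) 0 0, 0 < u (chart α t) + N := by
    intro t ht
    have htc : chart α t ∈ closedBall (0 : EuclideanSpace ℝ ι) 1 := by
      rw [mem_closedBall_zero_iff]
      have hti : ∀ i, |t i - 1 / 2| ≤ 1 / 2 := fun i ↦ by
        have := ((hunit t).1 ht) i
        rw [abs_le]; constructor <;> linarith [this.1, this.2]
      have h := norm_chart_sub_le (α := α) (by norm_num : (0 : ℝ) ≤ 1 / 2) hti
      have hhalf : chart α (fun _ : ι ↦ (1 / 2 : ℝ)) = (0 : EuclideanSpace ℝ ι) := by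
        unfold chart
        have : (fun i : ι ↦ 2 * α * (1 / 2 : ℝ) - α) = 0 := by funext i; simp; ring
        rw [this]; rfl
      rw [hhalf, sub_zero, abs_of_pos hα0] at h
      nlinarith
    linarith [hu0 _ htc]
  have hexp : ∀ t ∈ dyadicCube (ι := ι) 0 0, Real.exp (-w' t) = u (chart α t) + N := fun t ht ↦ by
    rw [hw']; simp only [neg_neg]; exact Real.exp_log (hpos_cube t ht)
  have h61' : ∫⁻ t in dyadicCube (ι := ι) 0 0, ENNReal.ofReal ((u (chart α t) + N) ^ p) ≤
      ENNReal.ofReal ((1 + p / (δ * (κ - p))) * (u x + N) ^ p) := by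
    have e1 : ∫⁻ t in dyadicCube (ι := ι) 0 0, ENNReal.ofReal ((u (chart α t) + N) ^ p) =
        ∫⁻ t in dyadicCube (ι := ι) 0 0, ENNReal.ofReal (Real.exp (-w' t) ^ p) :=
      setLIntegral_congr_fun (measurableSet_dyadicCube 0 0) fun t ht ↦ by rw [hexp t ht]
    rw [e1]
    have e2 : Real.exp (-w' t₀) = u x + N := by rw [hexp t₀ ht₀cube, hxt₀]
    rw [← e2]
    exact h61
  -- change of variables along the chart
  set c : ℝ := (2 * α) ^ n with hc
  have hc0 : 0 < c := by positivity
  have hchartm : Measurable (chart (ι := ι) α) := (continuous_chart α).measurable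
  have hmap : volume = ENNReal.ofReal c • Measure.map (chart α) (volume : Measure (ι → ℝ)) := by
    ext A hA
    rw [Measure.smul_apply, Measure.map_apply hchartm hA, volume_preimage_chart hα0.ne', smul_eq_mul,
      ← mul_assoc, ← ENNReal.ofReal_mul hc0.le, hc, abs_of_pos (by positivity),
      mul_inv_cancel₀ (by positivity), ENNReal.ofReal_one, one_mul]
  have hG : Measurable fun y : EuclideanSpace ℝ ι ↦ ENNReal.ofReal ((u y + N) ^ p) :=
    ENNReal.measurable_ofReal.comp ((hmeas.add_const N).pow_const p)
  have hpre : chart α ⁻¹' ball (0 : EuclideanSpace ℝ ι) α ⊆ dyadicCube (ι := ι) 0 0 := by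
    intro t ht
    rw [mem_preimage, mem_ball_zero_iff] at ht
    rw [hunit]; intro i
    have h := lt_of_le_of_lt (abs_ofLp_le_norm (chart α t) i) ht
    rw [chart_apply, abs_lt] at h
    constructor <;> nlinarith
  calc ∫⁻ y in ball (0 : EuclideanSpace ℝ ι) α, ENNReal.ofReal ((u y + N) ^ p)
      = ENNReal.ofReal c * ∫⁻ t in chart α ⁻¹' ball (0 : EuclideanSpace ℝ ι) α,
          ENNReal.ofReal ((u (chart α t) + N) ^ p) := by
        conv_lhs => rw [hmap]
        rw [Measure.restrict_smul, lintegral_smul_measure, setLIntegral_map measurableSet_ball hG hchartm,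
          smul_eq_mul]
    _ ≤ ENNReal.ofReal c * ∫⁻ t in dyadicCube (ι := ι) 0 0, ENNReal.ofReal ((u (chart α t) + N) ^ p) :=
        mul_le_mul_right (lintegral_mono_set hpre) _
    _ ≤ ENNReal.ofReal c * ENNReal.ofReal ((1 + p / (δ * (κ - p))) * (u x + N) ^ p) :=
        mul_le_mul_right h61' _
    _ = ENNReal.ofReal (constWH ι lam Λ m α * (u x + N) ^ p) := by
        rw [← ENNReal.ofReal_mul hc0.le]
        congr 1
        have hpκ2 : p / (δ * (κ - p)) = δ⁻¹ := by
          rw [hp, expWH, ← hκ]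
          have : κ - κ / 2 = κ / 2 := by ring
          rw [this]
          field_simp
        rw [hpκ2, constWH, ← hδ, hc]
        ring

/-- **GT Theorem 9.22, normalized, with a free exponent** `0 < q < κ`: for every `x ∈ B_α(0)`,
`∫_{B_α(0)} (u + N)^q ≤ (2α)ⁿ(1 + q/(δ(κ-q))) · (u(x) + N)^q`. (The Evans–Krylov summation uses
`q ≤ 1`.) [cite: GilbargTrudinger2001, Theorem 9.22 (proof, (9.61): "for p < κ")] -/
theorem setLIntegral_rpow_le_normalized_of_exponent [Nonempty ι] {U : Set (EuclideanSpace ℝ ι)} (hU : IsOpen U)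
    (hBU : closedBall (0 : EuclideanSpace ℝ ι) 1 ⊆ U) {u f : EuclideanSpace ℝ ι → ℝ} {N : ℝ}
    (hu : ContDiffOn ℝ 2 u U) (hu0 : ∀ y ∈ closedBall (0 : EuclideanSpace ℝ ι) 1, 0 ≤ u y)
    (hmeas : Measurable u) (hN : 0 < N) (hf : ∀ y ∈ ball (0 : EuclideanSpace ℝ ι) 1, |f y| ≤ N)
    {a : EuclideanSpace ℝ ι → Matrix ι ι ℝ} (ha : ∀ y ∈ ball (0 : EuclideanSpace ℝ ι) 1, (a y).IsSymm)
    {lam Λ : ℝ} (hlam0 : 0 < lam) (hΛ0 : 0 ≤ Λ)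
    (hlam : ∀ y ∈ ball (0 : EuclideanSpace ℝ ι) 1, ∀ ξ : ι → ℝ, lam * (ξ ⬝ᵥ ξ) ≤ ξ ⬝ᵥ (a y *ᵥ ξ))
    (hΛ : ∀ y ∈ ball (0 : EuclideanSpace ℝ ι) 1, ∀ ξ : ι → ℝ, ξ ⬝ᵥ (a y *ᵥ ξ) ≤ Λ * (ξ ⬝ᵥ ξ))
    (hsuper : ∀ y ∈ ball (0 : EuclideanSpace ℝ ι) 1,
      pair (a y) (hessianMatrix u (EuclideanSpace.basisFun ι ℝ) y) ≤ f y)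
    {m : ℕ} {α : ℝ} (hα0 : 0 < α) (hρ1 : 3 * α * Real.sqrt (Fintype.card ι) < 1)
    (hβl : Fintype.card ι * Λ ≤ 2 * (((m + 2 : ℕ) : ℝ) - 1) * lam * α ^ 2)
    {x : EuclideanSpace ℝ ι} (hx : x ∈ ball (0 : EuclideanSpace ℝ ι) α) {q : ℝ} (hq0 : 0 < q)
    (hqκ : q < kappa (deltaWH ι lam Λ m α) (growthC (Fintype.card ι) lam Λ m α)) :
    ∫⁻ y in ball (0 : EuclideanSpace ℝ ι) α, ENNReal.ofReal ((u y + N) ^ q) ≤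
      ENNReal.ofReal ((2 * α) ^ Fintype.card ι * (1 + q / (deltaWH ι lam Λ m α *
        (kappa (deltaWH ι lam Λ m α) (growthC (Fintype.card ι) lam Λ m α) - q))) * (u x + N) ^ q) := by
  set n := Fintype.card ι with hn
  have hn0 : n ≠ 0 := Fintype.card_ne_zero
  set δ := deltaWH ι lam Λ m α with hδ
  set C := growthC n lam Λ m α with hC
  set κ := kappa δ C with hκ
  set p := q with hp
  set w' : (ι → ℝ) → ℝ := fun t ↦ -Real.log (u (chart α t) + N) with hw'
  have hn1 : (1 : ℝ) ≤ n := by exact_mod_cast Fintype.card_pos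
  have hsqn : 1 ≤ Real.sqrt n := by rw [← Real.sqrt_one]; exact Real.sqrt_le_sqrt hn1
  have hα1 : α ^ 2 < 1 := by nlinarith
  obtain ⟨hθ0, hθhalf⟩ := thetaCube_pos (ι := ι) hlam0 hΛ0 m hα0 hα1
  have hδ0 : 0 < δ := by rw [hδ, deltaWH]; linarith
  have hδ1 : δ < 1 := by rw [hδ, deltaWH]; linarith
  have hρsq : (3 * α * Real.sqrt n) ^ 2 < 1 := by
    have : 0 ≤ 3 * α * Real.sqrt n := by positivity
    nlinarith
  have hC0 : 0 < C := by
    rw [hC, growthC]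
    exact div_pos (supBound_pos hn0 hlam0 hΛ0 m) (pow_pos (by linarith) _)
  have hκ0 : 0 < κ := kappa_pos hδ0 hδ1 hC0
  have hp0 : 0 < p := hq0
  have hpκ : p < κ := hqκ
  -- (9.57): the cube condition
  have hcc : CubeCondition w' δ C := by
    rw [hδ, deltaWH, hC, growthC]
    exact cubeCondition_negLog hU hBU hu hu0 hmeas hN hf ha hlam0 hΛ0 hlam hΛ hsuper hα0 hρ1 hβl
  -- (9.59)
  have hw'm : Measurable w' :=
    (Real.measurable_log.comp ((hmeas.comp (continuous_chart α).measurable).add_const N)).neg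
  have H59 : ∀ k : ℝ, 0 < volume (subLevel w' k) → ∀ t ∈ dyadicCube (ι := ι) 0 0,
      w' t - k ≤ C * (1 + Real.log (volume (subLevel w' k)).toReal / Real.log δ) :=
    fun k hk t ht ↦ sub_le_of_cube_condition hw'm hδ0 hδ1 hC0.le hcc hk ht
  -- the point `x` in the chart
  set t₀ : ι → ℝ := fun i ↦ (x.ofLp i + α) / (2 * α) with ht₀
  have hxt₀ : chart α t₀ = x := by
    unfold chart
    have : (fun i ↦ 2 * α * t₀ i - α) = x.ofLp := by
      funext i; rw [ht₀]; field_simp; ring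
    rw [this]
  have hcoordx : ∀ i, |x.ofLp i| < α := fun i ↦
    lt_of_le_of_lt (abs_ofLp_le_norm x i) (mem_ball_zero_iff.1 hx)
  have hunit : ∀ t : ι → ℝ, t ∈ dyadicCube (ι := ι) 0 0 ↔ ∀ i, 0 ≤ t i ∧ t i < 1 := fun t ↦ by
    rw [unitCube_eq, Set.mem_univ_pi]; simp only [mem_Ico]
  have ht₀cube : t₀ ∈ dyadicCube (ι := ι) 0 0 := by
    rw [hunit]; intro i
    have h := hcoordx i; rw [abs_lt] at h
    have e : t₀ i = (x.ofLp i + α) / (2 * α) := rfl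
    rw [e]
    constructor
    · exact div_nonneg (by linarith) (by positivity)
    · rw [div_lt_one (by positivity)]; linarith
  -- (9.61) on the unit cube
  have h61 := lintegral_rpow_exp_neg_le hw'm hδ0 hδ1 hC0 H59 ht₀cube hp0 hpκ
  -- identify `e^{-w'} = (u ∘ chart) + N` on the cube
  have hpos_cube : ∀ t ∈ dyadicCube (ι := ι) 0 0, 0 < u (chart α t) + N := by
    intro t ht
    have htc : chart α t ∈ closedBall (0 : EuclideanSpace ℝ ι) 1 := by
      rw [mem_closedBall_zero_iff]
      have hti : ∀ i, |t i - 1 / 2| ≤ 1 / 2 := fun i ↦ by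
        have := ((hunit t).1 ht) i
        rw [abs_le]; constructor <;> linarith [this.1, this.2]
      have h := norm_chart_sub_le (α := α) (by norm_num : (0 : ℝ) ≤ 1 / 2) hti
      have hhalf : chart α (fun _ : ι ↦ (1 / 2 : ℝ)) = (0 : EuclideanSpace ℝ ι) := by
        unfold chart
        have : (fun i : ι ↦ 2 * α * (1 / 2 : ℝ) - α) = 0 := by funext i; simp; ring
        rw [this]; rfl
      rw [hhalf, sub_zero, abs_of_pos hα0] at h
      nlinarith
    linarith [hu0 _ htc]
  have hexp : ∀ t ∈ dyadicCube (ι := ι) 0 0, Real.exp (-w' t) = u (chart α t) + N := fun t ht ↦ by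
    rw [hw']; simp only [neg_neg]; exact Real.exp_log (hpos_cube t ht)
  have h61' : ∫⁻ t in dyadicCube (ι := ι) 0 0, ENNReal.ofReal ((u (chart α t) + N) ^ p) ≤
      ENNReal.ofReal ((1 + p / (δ * (κ - p))) * (u x + N) ^ p) := by
    have e1 : ∫⁻ t in dyadicCube (ι := ι) 0 0, ENNReal.ofReal ((u (chart α t) + N) ^ p) =
        ∫⁻ t in dyadicCube (ι := ι) 0 0, ENNReal.ofReal (Real.exp (-w' t) ^ p) :=
      setLIntegral_congr_fun (measurableSet_dyadicCube 0 0) fun t ht ↦ by rw [hexp t ht]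
    rw [e1]
    have e2 : Real.exp (-w' t₀) = u x + N := by rw [hexp t₀ ht₀cube, hxt₀]
    rw [← e2]
    exact h61
  -- change of variables along the chart
  set c : ℝ := (2 * α) ^ n with hc
  have hc0 : 0 < c := by positivity
  have hchartm : Measurable (chart (ι := ι) α) := (continuous_chart α).measurable
  have hmap : volume = ENNReal.ofReal c • Measure.map (chart α) (volume : Measure (ι → ℝ)) := by
    ext A hA
    rw [Measure.smul_apply, Measure.map_apply hchartm hA, volume_preimage_chart hα0.ne', smul_eq_mul,
      ← mul_assoc, ← ENNReal.ofReal_mul hc0.le, hc, abs_of_pos (by positivity),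
      mul_inv_cancel₀ (by positivity), ENNReal.ofReal_one, one_mul]
  have hG : Measurable fun y : EuclideanSpace ℝ ι ↦ ENNReal.ofReal ((u y + N) ^ p) :=
    ENNReal.measurable_ofReal.comp ((hmeas.add_const N).pow_const p)
  have hpre : chart α ⁻¹' ball (0 : EuclideanSpace ℝ ι) α ⊆ dyadicCube (ι := ι) 0 0 := by
    intro t ht
    rw [mem_preimage, mem_ball_zero_iff] at ht
    rw [hunit]; intro i
    have h := lt_of_le_of_lt (abs_ofLp_le_norm (chart α t) i) ht
    rw [chart_apply, abs_lt] at h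
    constructor <;> nlinarith
  calc ∫⁻ y in ball (0 : EuclideanSpace ℝ ι) α, ENNReal.ofReal ((u y + N) ^ p)
      = ENNReal.ofReal c * ∫⁻ t in chart α ⁻¹' ball (0 : EuclideanSpace ℝ ι) α,
          ENNReal.ofReal ((u (chart α t) + N) ^ p) := by
        conv_lhs => rw [hmap]
        rw [Measure.restrict_smul, lintegral_smul_measure, setLIntegral_map measurableSet_ball hG hchartm,
          smul_eq_mul]
    _ ≤ ENNReal.ofReal c * ∫⁻ t in dyadicCube (ι := ι) 0 0, ENNReal.ofReal ((u (chart α t) + N) ^ p) :=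
        mul_le_mul_right (lintegral_mono_set hpre) _
    _ ≤ ENNReal.ofReal c * ENNReal.ofReal ((1 + p / (δ * (κ - p))) * (u x + N) ^ p) :=
        mul_le_mul_right h61' _
    _ = ENNReal.ofReal (c * (1 + p / (δ * (κ - p))) * (u x + N) ^ p) := by
        rw [← ENNReal.ofReal_mul hc0.le]
        congr 1
        ring

end Literature.Analysis.PDE.KrylovSafonov

end
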